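/-
Copyright: pub-hodgecm formalisation cell (harness21, 2026). New file (not vendored).
-/
import Summits.HodgeConjecture.HodgeCM.Geometry.Facts

/-!
# rfwf Prop 2.2 — complexification helpers

Elementary lemmas about the complexified operations `pullC`, `cup2C`, `trC`, `quadC`, `conj` of
`HodgeCM.Geometry.Universe`, derived from the rational model facts by base change. Used by the proof of
the surface criterion (`HodgeCM.Proofs.SurfaceCriterion`). No placeholders, no new hypotheses.
-/

noncomputable section

open scoped TensorProduct

namespace HodgeCM

open Literature.AlgebraicGeometry.Motives
open Literature.AlgebraicGeometry.Motives.HodgeStructure (conj ofRat conj_baseChange conj_smul conj_conj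
  conj_tmul)

namespace Universe

variable {U : Universe}

/-! ### Pure-tensor formulas -/

/-- (Ported verbatim from the HodgeCMPerL package; no docstring in the source.) -/
@[simp] theorem pullC_tmul {X Y : U.Var} (f : U.Mor X Y) (k : ℕ) (z : ℂ) (x : U.Coh Y k) :
    U.pullC f k (z ⊗ₜ x) = z ⊗ₜ U.pull f k x := rfl

/-- (Ported verbatim from the HodgeCMPerL package; no docstring in the source.) -/
@[simp] theorem cup2C_tmul (X : U.Var) (k : ℕ) (z w : ℂ) (x y : U.Coh X k) :
    U.cup2C X k (z ⊗ₜ x) (w ⊗ₜ y) = (z * w) ⊗ₜ U.cup X k k x y := rfl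

/-- (Ported verbatim from the HodgeCMPerL package; no docstring in the source.) -/
@[simp] theorem trC_tmul (X : U.Var) (k : ℕ) (z : ℂ) (x : U.Coh X k) :
    U.trC X k (z ⊗ₜ x) = (U.tr X k x) • z := by
  simp [Universe.trC]

/-- (Ported verbatim from the HodgeCMPerL package; no docstring in the source.) -/
theorem ofRat_eq (X : U.Var) (k : ℕ) (x : U.Coh X k) : (ofRat x : U.CohC X k) = (1 : ℂ) ⊗ₜ x := rfl

/-! ### `pullC` is functorial and multiplicative -/

/-- (Ported verbatim from the HodgeCMPerL package; no docstring in the source.) -/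
theorem pullC_comp (hc : U.Fact_pull_comp) {X Y Z : U.Var} (f : U.Mor X Y) (g : U.Mor Y Z) (k : ℕ) :
    U.pullC (U.comp f g) k = U.pullC f k ∘ₗ U.pullC g k := by
  simp only [Universe.pullC]
  rw [hc, LinearMap.baseChange_comp]

/-- (Ported verbatim from the HodgeCMPerL package; no docstring in the source.) -/
theorem pullC_comp_apply (hc : U.Fact_pull_comp) {X Y Z : U.Var} (f : U.Mor X Y) (g : U.Mor Y Z) (k : ℕ)
    (x : U.CohC Z k) : U.pullC (U.comp f g) k x = U.pullC f k (U.pullC g k x) := by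
  rw [pullC_comp hc]; rfl

/-- (Ported verbatim from the HodgeCMPerL package; no docstring in the source.) -/
theorem pullC_cup2C (hcup : U.Fact_pull_cup) {X Y : U.Var} (f : U.Mor X Y) (k : ℕ) (x y : U.CohC Y k) :
    U.pullC f (k + k) (U.cup2C Y k x y) = U.cup2C X k (U.pullC f k x) (U.pullC f k y) := by
  induction x using TensorProduct.induction_on with
  | zero => simp
  | add a a' ha ha' => simp only [map_add, LinearMap.add_apply, ha, ha']
  | tmul z a =>
    induction y using TensorProduct.induction_on with
    | zero => simp
    | add b b' hb hb' => simp only [map_add, hb, hb']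
    | tmul w b => rw [cup2C_tmul, pullC_tmul, pullC_tmul, pullC_tmul, cup2C_tmul, hcup]

/-- (Ported verbatim from the HodgeCMPerL package; no docstring in the source.) -/
theorem pullC_quadC (hcup : U.Fact_pull_cup) {X Y : U.Var} (f : U.Mor X Y) (a b c d : U.CohC Y 1) :
    U.pullC f 4 (U.quadC Y a b c d) =
      U.quadC X (U.pullC f 1 a) (U.pullC f 1 b) (U.pullC f 1 c) (U.pullC f 1 d) := by
  show U.pullC f (2 + 2) _ = _
  rw [Universe.quadC, pullC_cup2C hcup]
  show U.cup2C X 2 (U.pullC f (1 + 1) _) (U.pullC f (1 + 1) _) = _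
  rw [pullC_cup2C hcup, pullC_cup2C hcup]
  rfl

/-- (Ported verbatim from the HodgeCMPerL package; no docstring in the source.) -/
theorem conj_pullC {X Y : U.Var} (f : U.Mor X Y) (k : ℕ) (x : U.CohC Y k) :
    conj (U.pullC f k x) = U.pullC f k (conj x) :=
  conj_baseChange _ _

/-! ### Alternation rules for `quadC` (from M19, M20 by base change) -/

/-- (Ported verbatim from the HodgeCMPerL package; no docstring in the source.) -/
theorem cup2C_comm1 (h : U.Fact_cup_comm1) (X : U.Var) (x y : U.CohC X 1) :
    U.cup2C X 1 x y = -(U.cup2C X 1 y x) := by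
  induction x using TensorProduct.induction_on with
  | zero => simp
  | add a a' ha ha' => simp only [map_add, LinearMap.add_apply, ha, ha', neg_add]
  | tmul z a =>
    induction y using TensorProduct.induction_on with
    | zero => simp
    | add b b' hb hb' => simp only [map_add, LinearMap.add_apply, hb, hb', neg_add]
    | tmul w b =>
      rw [cup2C_tmul, cup2C_tmul, h X a b, TensorProduct.tmul_neg, mul_comm]

/-- (Ported verbatim from the HodgeCMPerL package; no docstring in the source.) -/
theorem cup2C_interchange (h : U.Fact_cup_interchange) (X : U.Var) (a b c d : U.CohC X 1) :
    U.cup2C X 2 (U.cup2C X 1 a b) (U.cup2C X 1 c d) =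
      -(U.cup2C X 2 (U.cup2C X 1 a c) (U.cup2C X 1 b d)) := by
  induction a using TensorProduct.induction_on with
  | zero => simp
  | add a a' ha ha' => simp only [map_add, LinearMap.add_apply, ha, ha', neg_add]
  | tmul za a =>
  induction b using TensorProduct.induction_on with
  | zero => simp
  | add b b' hb hb' => simp only [map_add, LinearMap.add_apply, hb, hb', neg_add]
  | tmul zb b =>
  induction c using TensorProduct.induction_on with
  | zero => simp
  | add c c' hc hc' => simp only [map_add, LinearMap.add_apply, hc, hc', neg_add]
  | tmul zc c =>
  induction d using TensorProduct.induction_on with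
  | zero => simp
  | add d d' hd hd' => simp only [map_add, hd, hd', neg_add]
  | tmul zd d =>
    simp only [cup2C_tmul]
    rw [h X a b c d, TensorProduct.tmul_neg, ← TensorProduct.neg_tmul, ← TensorProduct.neg_tmul]
    congr 1; ring

/-- `(a ∪ c) ∪ (d ∪ b) = (a ∪ b) ∪ (c ∪ d)`: the rearrangement matching the Weil generator pulled back
to the surface with the integrand of the period. -/
theorem quadC_acdb (h1 : U.Fact_cup_comm1) (h2 : U.Fact_cup_interchange) (X : U.Var)
    (a b c d : U.CohC X 1) : U.quadC X a c d b = U.quadC X a b c d := by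
  simp only [Universe.quadC]
  rw [cup2C_comm1 h1 X d b, map_neg, cup2C_interchange h2 X a b c d]

/-! ### From rational operator identities to complexified ones -/

/-- (Ported verbatim from the HodgeCMPerL package; no docstring in the source.) -/
theorem pullC_pullC_of_comp_eq {X Y Z : U.Var} {f : U.Mor X Y} {g : U.Mor Y Z} {h : U.Mor X Z} {k : ℕ}
    (e : U.pull f k ∘ₗ U.pull g k = U.pull h k) (x : U.CohC Z k) :
    U.pullC f k (U.pullC g k x) = U.pullC h k x := by
  have h2 := congrArg (LinearMap.baseChange ℂ) e
  rw [LinearMap.baseChange_comp] at h2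
  exact LinearMap.congr_fun h2 x

/-- (Ported verbatim from the HodgeCMPerL package; no docstring in the source.) -/
theorem baseChange_baseChange_of_comp_eq {V₁ V₂ V₃ : Type*} [AddCommGroup V₁] [Module ℚ V₁]
    [AddCommGroup V₂] [Module ℚ V₂] [AddCommGroup V₃] [Module ℚ V₃]
    {f : V₂ →ₗ[ℚ] V₃} {g : V₁ →ₗ[ℚ] V₂} {h : V₁ →ₗ[ℚ] V₃} (e : f ∘ₗ g = h) (x : ℂ ⊗[ℚ] V₁) :
    f.baseChange ℂ (g.baseChange ℂ x) = h.baseChange ℂ x := by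
  have h2 := congrArg (LinearMap.baseChange ℂ) e
  rw [LinearMap.baseChange_comp] at h2
  exact LinearMap.congr_fun h2 x

/-- A `ℚ`-linear bijection stays a bijection after `ℂ ⊗_ℚ -`: explicit two-sided inverse. -/
theorem baseChange_inverse {V₁ V₂ : Type*} [AddCommGroup V₁] [Module ℚ V₁] [AddCommGroup V₂] [Module ℚ V₂]
    (f : V₁ →ₗ[ℚ] V₂) (hf : Function.Bijective f) :
    ∃ g : ℂ ⊗[ℚ] V₂ →ₗ[ℂ] ℂ ⊗[ℚ] V₁,
      (∀ x, f.baseChange ℂ (g x) = x) ∧ (∀ x, g (f.baseChange ℂ x) = x) := by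
  let E := LinearEquiv.ofBijective f hf
  refine ⟨(E.symm : V₂ →ₗ[ℚ] V₁).baseChange ℂ, fun x => ?_, fun x => ?_⟩
  · have h1 : f ∘ₗ (E.symm : V₂ →ₗ[ℚ] V₁) = LinearMap.id := by
      ext v; exact E.apply_symm_apply v
    rw [baseChange_baseChange_of_comp_eq h1, LinearMap.baseChange_id]; rfl
  · have h1 : (E.symm : V₂ →ₗ[ℚ] V₁) ∘ₗ f = LinearMap.id := by
      ext v; exact E.symm_apply_apply v
    rw [baseChange_baseChange_of_comp_eq h1, LinearMap.baseChange_id]; rfl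

/-! ### Weil generators as a function of the four eigenclasses -/

/-- `pr₀^* c₀ ∪ pr₁^* c₁ ∪ pr₂^* c₂ ∪ pr₃^* c₃`. -/
def weilGen (K : CMField) (Φ : Fin 4 → CMType K) (c : (i : Fin 4) → U.CohC (U.cmAV K (Φ i)) 1) :
    U.CohC (U.prod4 K Φ) 4 :=
  U.quadC _ (U.pullC (U.pr4 K Φ 0) 1 (c 0)) (U.pullC (U.pr4 K Φ 1) 1 (c 1))
    (U.pullC (U.pr4 K Φ 2) 1 (c 2)) (U.pullC (U.pr4 K Φ 3) 1 (c 3))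

/-- (Ported verbatim from the HodgeCMPerL package; no docstring in the source.) -/
theorem weilGen_mem {K : CMField} {Φ : Fin 4 → CMType K} {σ : K →+* ℂ}
    {c : (i : Fin 4) → U.CohC (U.cmAV K (Φ i)) 1} (hc : ∀ i, c i ∈ U.eigenLine K (Φ i) σ) :
    U.weilGen K Φ c ∈ U.weilGenerators K Φ :=
  ⟨σ, c, hc, rfl⟩

/-- (Ported verbatim from the HodgeCMPerL package; no docstring in the source.) -/
theorem alphaLine_le_eigenLine (K : CMField) (Φ : CMType K) (σ : K →+* ℂ) :
    U.alphaLine K Φ σ ≤ U.eigenLine K Φ σ :=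
  inf_le_right

/-- (Ported verbatim from the HodgeCMPerL package; no docstring in the source.) -/
theorem mem_eigenLine_iff {K : CMField} {Φ : CMType K} {σ : K →+* ℂ} {x : U.CohC (U.cmAV K Φ) 1} :
    x ∈ U.eigenLine K Φ σ ↔ ∀ e : K, ((U.cmAct K Φ).ι e).baseChange ℂ x = σ e • x := by
  simp [Universe.eigenLine, Submodule.mem_iInf]

/-! ### `ofRat` is injective; polynomials applied to eigenvectors -/

omit U in
/-- (Ported verbatim from the HodgeCMPerL package; no docstring in the source.) -/
theorem ofRat_injective {V : Type*} [AddCommGroup V] [Module ℚ V] :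
    Function.Injective (ofRat : V → ℂ ⊗[ℚ] V) := by
  obtain ⟨ℓ, hℓ⟩ := LinearMap.exists_leftInverse_of_injective (Algebra.linearMap ℚ ℂ)
    (LinearMap.ker_eq_bot.mpr (algebraMap ℚ ℂ).injective)
  have h1 : ℓ 1 = 1 := by
    have := LinearMap.congr_fun hℓ 1
    simpa using this
  intro v w hvw
  have := congrArg (fun x => TensorProduct.lid ℚ V (ℓ.rTensor V x)) hvw
  simpa [HodgeStructure.ofRat_apply, h1] using this

omit U in
/-- (Ported verbatim from the HodgeCMPerL package; no docstring in the source.) -/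
theorem ofRat_baseChange {V W : Type*} [AddCommGroup V] [Module ℚ V] [AddCommGroup W] [Module ℚ W]
    (f : V →ₗ[ℚ] W) (v : V) : (ofRat (f v) : ℂ ⊗[ℚ] W) = f.baseChange ℂ (ofRat v) := rfl

omit U in
/-- `p(T) g = p(μ) g` for an eigenvector `g` (possibly zero) of a `ℂ`-linear `T` on a complexified
space, `p ∈ ℚ[X]`. -/
theorem aeval_apply_of_eigen {W : Type*} [AddCommGroup W] [Module ℚ W] (T : ℂ ⊗[ℚ] W →ₗ[ℂ] ℂ ⊗[ℚ] W)
    {μ : ℂ} {g : ℂ ⊗[ℚ] W} (hg : T g = μ • g) (p : Polynomial ℚ) :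
    Polynomial.aeval T p g = (Polynomial.aeval μ p) • g := by
  induction p using Polynomial.induction_on' with
  | add p q hp hq => simp only [map_add, LinearMap.add_apply, hp, hq, add_smul]
  | monomial n a =>
    simp only [Polynomial.aeval_monomial, Algebra.algebraMap_eq_smul_one, smul_mul_assoc, one_mul,
      LinearMap.smul_apply]
    have : (T ^ n) g = μ ^ n • g := by
      induction n with
      | zero => simp
      | succ n ih => rw [pow_succ', Module.End.mul_apply, ih, map_smul, hg, smul_smul, ← pow_succ]
    rw [this, smul_assoc]

end Universe

end HodgeCM

end
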